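import Mathlib
import HarnessLib

/-!
# Integration of a log-derivative bound along a gauge (the abstract Grönwall step of near-critical stability)

Topic `Literature/Probability/Percolation`; family `crit-perc` / near-critical percolation.
PROOFS ONLY (no definition, no named fact).  The real-analysis step shared by every
"differential inequality" proof of near-critical stability — H. Kesten, *Scaling relations for
2D-percolation* (1987), Lemma 8; P. Nolin, *Near-critical percolation in two dimensions* (2008),
§6.1, proof of Thm. 27 ("integrate `|d/dt log P̂_t(A)| ≤ C · d/dt P_t(crossing)` between `p` and
`1/2`"); W. Werner, *Lectures on two-dimensional critical percolation* (2009), Lecture 6, §5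
("`|d/dp log π̂_p(n)| ≤ cst d/dp h_p(n)`. If we integrate this relation from `p = 1/2` to `p'` …
we get" Lemma 6.3) — in MODEL-FREE form: for real functions `f, g` continuous on `[a, b]` and
differentiable on `(a, b)` with `|f'| ≤ K · g' · f` on `(a, b)`, the products `f · e^{∓ K g}` are
monotone on `[a, b]`, whence `f b ≤ e^{K (g b − g a)} f a` and `f a ≤ e^{K (g b − g a)} f b`
(`le_exp_mul_of_abs_deriv_le_gauge`); if the gauge `g` takes values in `[0, 1]` (a probability),
`K ≥ 0` and `f ≥ 0` at the endpoints, the factor is at most `e^K`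
(`le_exp_mul_of_abs_deriv_le_gauge_of_mem_Icc`); and the same with one-sided derivatives
within a larger interval `[c, d] ⊇ [a, b]`, the shape in which Russo's formula is recorded for
parameters clamped to `[0, 1]` (`le_exp_mul_of_abs_derivWithin_le_gauge`).  No positivity of `f` in
the interior, no monotonicity of `g` and no logarithm is needed.

The tree's `real_ratio_le_exp_of_pivotal_bound` (`WernerDifferentialInequalities.lean`) is the
instance `f = P_t(E)`, `g = h_t(N)` for site percolation on `𝕋`, with Russo's inequality
supplying the hypothesis.  The abstract form is the one needed for other models — bond
percolation on `ℤ²` and periodic inhomogeneous product measures, e.g. the Kesten-window stubs of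
`Summit.CriticalPhenomena.CardyFormulaZ2.Theses.CardySelfRefinement.GradientComparability`
(line `monotone-product-coordinates`, stub `stub_sliceKesten`), where `f` is a pivotal sum or an
arm probability and `g` a crossing probability, both polynomials in the edge parameter.

## References

* H. Kesten, Scaling relations for 2D-percolation, *Comm. Math. Phys.* 109 (1987) 109–156,
  Lemma 8 [KestenScalingCMP1987].
* P. Nolin, Near-critical percolation in two dimensions, *Electron. J. Probab.* 13 (2008), §6.1,
  Thm. 27 and its proof (arXiv 0711.4948: Thm. 26) [Nolin2008].
* W. Werner, *Lectures on two-dimensional critical percolation*, IAS/Park City Math. Ser. 16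
  (2009), Lecture 6, §5 (the integration before Lemma 6.3) [WernerPCMI2009].

Mathlib: `antitoneOn_of_deriv_nonpos`, `monotoneOn_of_deriv_nonneg`, `HasDerivAt.mul`,
`HasDerivAt.exp`, `Real.exp_le_exp`, `HasDerivWithinAt.hasDerivAt`.  Tree:
`real_ratio_le_exp_of_pivotal_bound` (the site-`𝕋` instance, `WernerDifferentialInequalities.lean`).
-/

noncomputable section

open Set

namespace Literature.Probability.Percolation

/-- **The abstract Grönwall step of near-critical stability.**  If `f, g` are continuous on
`[a, b]`, differentiable on `(a, b)` with derivatives `f', g'`, and `|f' x| ≤ K · g' x · f x` on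
`(a, b)`, then `f b ≤ e^{K (g b − g a)} · f a` and `f a ≤ e^{K (g b − g a)} · f b`.  Proof:
`f · e^{-K g}` is non-increasing and `f · e^{K g}` non-decreasing on `[a, b]`
(`antitoneOn_of_deriv_nonpos`, `monotoneOn_of_deriv_nonneg`).  This is the integration
"`|d/dt log f| ≤ K d/dt g` between the two parameters" of the printed proofs, without
logarithms or positivity. [cite: Nolin2008, §6.1, Thm. 27 (proof; arXiv 0711.4948: Thm. 26)] [cite: WernerPCMI2009, Lecture 6, §5 (integration before Lemma 6.3)] [cite: KestenScalingCMP1987, Lemma 8] -/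
theorem le_exp_mul_of_abs_deriv_le_gauge {f g f' g' : ℝ → ℝ} {a b K : ℝ} (hab : a ≤ b)
    (hfc : ContinuousOn f (Icc a b)) (hgc : ContinuousOn g (Icc a b))
    (hf : ∀ x ∈ Ioo a b, HasDerivAt f (f' x) x) (hg : ∀ x ∈ Ioo a b, HasDerivAt g (g' x) x)
    (hle : ∀ x ∈ Ioo a b, |f' x| ≤ K * g' x * f x) :
    f b ≤ Real.exp (K * (g b - g a)) * f a ∧ f a ≤ Real.exp (K * (g b - g a)) * f b := by
  have hconv : Convex ℝ (Icc a b) := convex_Icc a b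
  have haD : a ∈ Icc a b := left_mem_Icc.2 hab
  have hbD : b ∈ Icc a b := right_mem_Icc.2 hab
  constructor
  · -- `Ψ = f · e^{-K g}` is non-increasing on `[a, b]`
    set Ψ : ℝ → ℝ := fun x => f x * Real.exp (-K * g x) with hΨ
    have hΨc : ContinuousOn Ψ (Icc a b) := hfc.mul (continuousOn_const.mul hgc).rexp
    have hΨd : ∀ x ∈ Ioo a b, HasDerivAt Ψ
        (f' x * Real.exp (-K * g x) + f x * (Real.exp (-K * g x) * (-K * g' x))) x :=
      fun x hx => (hf x hx).mul ((hg x hx).const_mul (-K)).exp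
    have hΨdiff : DifferentiableOn ℝ Ψ (interior (Icc a b)) := by
      rw [interior_Icc]
      exact fun x hx => (hΨd x hx).differentiableAt.differentiableWithinAt
    have hΨ' : ∀ x ∈ interior (Icc a b), deriv Ψ x ≤ 0 := by
      rw [interior_Icc]
      intro x hx
      rw [(hΨd x hx).deriv]
      have h1 : f' x ≤ K * g' x * f x := (le_abs_self _).trans (hle x hx)
      have he : 0 < Real.exp (-K * g x) := Real.exp_pos _
      nlinarith [h1, he]
    have hanti : AntitoneOn Ψ (Icc a b) := antitoneOn_of_deriv_nonpos hconv hΨc hΨdiff hΨ'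
    have hba : f b * Real.exp (-K * g b) ≤ f a * Real.exp (-K * g a) := hanti haD hbD hab
    have key := mul_le_mul_of_nonneg_right hba (Real.exp_pos (K * g b)).le
    have hL : f b * Real.exp (-K * g b) * Real.exp (K * g b) = f b := by
      rw [mul_assoc, ← Real.exp_add, show -K * g b + K * g b = 0 by ring, Real.exp_zero, mul_one]
    have hR : f a * Real.exp (-K * g a) * Real.exp (K * g b) = Real.exp (K * (g b - g a)) * f a := by
      rw [mul_assoc, ← Real.exp_add, mul_comm (f a), show -K * g a + K * g b = K * (g b - g a) by ring]
    rwa [hL, hR] at key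
  · -- `Ψ = f · e^{K g}` is non-decreasing on `[a, b]`
    set Ψ : ℝ → ℝ := fun x => f x * Real.exp (K * g x) with hΨ
    have hΨc : ContinuousOn Ψ (Icc a b) := hfc.mul (continuousOn_const.mul hgc).rexp
    have hΨd : ∀ x ∈ Ioo a b, HasDerivAt Ψ
        (f' x * Real.exp (K * g x) + f x * (Real.exp (K * g x) * (K * g' x))) x :=
      fun x hx => (hf x hx).mul ((hg x hx).const_mul K).exp
    have hΨdiff : DifferentiableOn ℝ Ψ (interior (Icc a b)) := by
      rw [interior_Icc]
      exact fun x hx => (hΨd x hx).differentiableAt.differentiableWithinAt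
    have hΨ' : ∀ x ∈ interior (Icc a b), 0 ≤ deriv Ψ x := by
      rw [interior_Icc]
      intro x hx
      rw [(hΨd x hx).deriv]
      have h1 : -(K * g' x * f x) ≤ f' x := (neg_le_neg (hle x hx)).trans (neg_abs_le _)
      have he : 0 < Real.exp (K * g x) := Real.exp_pos _
      nlinarith [h1, he]
    have hmono : MonotoneOn Ψ (Icc a b) := monotoneOn_of_deriv_nonneg hconv hΨc hΨdiff hΨ'
    have hab' : f a * Real.exp (K * g a) ≤ f b * Real.exp (K * g b) := hmono haD hbD hab
    have key := mul_le_mul_of_nonneg_right hab' (Real.exp_pos (-K * g a)).le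
    have hL : f a * Real.exp (K * g a) * Real.exp (-K * g a) = f a := by
      rw [mul_assoc, ← Real.exp_add, show K * g a + -K * g a = 0 by ring, Real.exp_zero, mul_one]
    have hR : f b * Real.exp (K * g b) * Real.exp (-K * g a) = Real.exp (K * (g b - g a)) * f b := by
      rw [mul_assoc, ← Real.exp_add, mul_comm (f b), show K * g b + -K * g a = K * (g b - g a) by ring]
    rwa [hL, hR] at key

/-- **The abstract Grönwall step with a probability gauge.**  Under the hypotheses of
`le_exp_mul_of_abs_deriv_le_gauge`, if moreover `K ≥ 0`, the gauge satisfies `g a, g b ∈ [0, 1]` and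
`f a, f b ≥ 0`, then `f b ≤ e^K f a` and `f a ≤ e^K f b` — the shape "`e^{-K} P_{1/2}(E) ≤ P_p(E)
≤ e^{K} P_{1/2}(E)`" of the printed statements (Werner 2009, Lemma 6.3; Nolin 2008, Thm. 27),
with `g` a crossing probability. [cite: WernerPCMI2009, Lecture 6, §5 and Lemma 6.3] [cite: Nolin2008, §6.1, Thm. 27 (proof; arXiv 0711.4948: Thm. 26)] -/
theorem le_exp_mul_of_abs_deriv_le_gauge_of_mem_Icc {f g f' g' : ℝ → ℝ} {a b K : ℝ} (hab : a ≤ b)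
    (hfc : ContinuousOn f (Icc a b)) (hgc : ContinuousOn g (Icc a b))
    (hf : ∀ x ∈ Ioo a b, HasDerivAt f (f' x) x) (hg : ∀ x ∈ Ioo a b, HasDerivAt g (g' x) x)
    (hle : ∀ x ∈ Ioo a b, |f' x| ≤ K * g' x * f x) (hK : 0 ≤ K)
    (hga : g a ∈ Icc (0 : ℝ) 1) (hgb : g b ∈ Icc (0 : ℝ) 1) (hfa : 0 ≤ f a) (hfb : 0 ≤ f b) :
    f b ≤ Real.exp K * f a ∧ f a ≤ Real.exp K * f b := by
  obtain ⟨h₁, h₂⟩ := le_exp_mul_of_abs_deriv_le_gauge hab hfc hgc hf hg hle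
  have hexp : Real.exp (K * (g b - g a)) ≤ Real.exp K := by
    rw [Real.exp_le_exp]
    nlinarith [hga.1, hgb.2, hK]
  exact ⟨h₁.trans (mul_le_mul_of_nonneg_right hexp hfa), h₂.trans (mul_le_mul_of_nonneg_right hexp hfb)⟩

/-- **The abstract Grönwall step for one-sided derivatives within a larger interval.**  If on
`[c, d] ⊇ [a, b]` the functions `f, g` have derivatives `f', g'` within `[c, d]` at every point
(the shape of Russo's formula for parameters clamped to `[0, 1]`), and `|f' x| ≤ K · g' x · f x`
on `(a, b)`, then `f b ≤ e^{K (g b − g a)} f a` and `f a ≤ e^{K (g b − g a)} f b`: within-derivatives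
at interior points are derivatives (`HasDerivWithinAt.hasDerivAt`, `Icc_mem_nhds`) and give
continuity on `[c, d]`. [cite: Nolin2008, §6.1, Thm. 27 (proof; arXiv 0711.4948: Thm. 26)] [cite: KestenScalingCMP1987, Lemma 8] -/
theorem le_exp_mul_of_abs_derivWithin_le_gauge {f g f' g' : ℝ → ℝ} {a b c d K : ℝ} (hca : c ≤ a)
    (hab : a ≤ b) (hbd : b ≤ d)
    (hf : ∀ x ∈ Icc c d, HasDerivWithinAt f (f' x) (Icc c d) x)
    (hg : ∀ x ∈ Icc c d, HasDerivWithinAt g (g' x) (Icc c d) x)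
    (hle : ∀ x ∈ Ioo a b, |f' x| ≤ K * g' x * f x) :
    f b ≤ Real.exp (K * (g b - g a)) * f a ∧ f a ≤ Real.exp (K * (g b - g a)) * f b := by
  have hsub : Icc a b ⊆ Icc c d := Icc_subset_Icc hca hbd
  have hnhds : ∀ x ∈ Ioo a b, Icc c d ∈ nhds x := fun x hx =>
    Icc_mem_nhds (lt_of_le_of_lt hca hx.1) (lt_of_lt_of_le hx.2 hbd)
  refine le_exp_mul_of_abs_deriv_le_gauge hab ?_ ?_ (fun x hx => (hf x (hsub (Ioo_subset_Icc_self hx))).hasDerivAt (hnhds x hx))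
    (fun x hx => (hg x (hsub (Ioo_subset_Icc_self hx))).hasDerivAt (hnhds x hx)) hle
  · exact fun x hx => ((hf x (hsub hx)).continuousWithinAt.mono hsub)
  · exact fun x hx => ((hg x (hsub hx)).continuousWithinAt.mono hsub)

end Literature.Probability.Percolation

end
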